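import Mathlib
import Summits.Ventures.PercRepro2.ZMeanProof
import Summits.Ventures.PercRepro2.PendantRoot
import Summits.Ventures.PercRepro2.HMFLeaf

/-!
# A pendant `a₃` at the marker `b`: events, masses and the mean-field sum
(blind cell PercRepro2, night-1 g6; exploration lens, NIGHT1-G6.md §9)

`a₃` is a leaf attached to `b` by the edge `f` (`q = p f`).  `a₃` is in a root cluster iff `f` is
open and `b` is: `PD = Q ∩ ({f closed} ∪ bN)` with `bN = {b ∉ C₁ ∪ C₂}`, `T = Q ∩ {f open} ∩ {b ∈ C₂}`,
`T′ = Q ∩ {f open} ∩ {b ∈ C₁}` (`PDEvent_pendant_b`, `TEvent_pendant_b`, `TEvent'_pendant_b`), so every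
mass is `(1 − q)`/`q` times a star-free mass (`prob_PD_inter_b`, `prob_T_inter_b`, `prob_T'_inter_b`).
Exploring `C(a₃)`: `{a₃}` or `C(b)` (`Xhat_pendant_b`); on a cluster containing `b` the `b`-shares
vanish, so `termW` is the functional `Fb = 1_{a₁ ∉ S} 1_{a₂ ∈ S} g_{a₁}(S) + 1_{a₁ ∈ S} 1_{a₂ ∉ S} g_{a₂}(S)`
(`termW_eq_Fb`), whose pinned expectation is `P′(b ∈ C₂, o ∈ C₁, Q) + P′(b ∈ C₁, o ∈ C₂, Q)`
(`expect_Fb`) — no Rao–Blackwell term survives.  Used by `HMFPendantB.lean`.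
-/

namespace Summit.Ventures.PercRepro2

namespace HMFPendantB

open UnionCluster CovForm PendantRoot HMFPendantRoot

variable {V : Type*} {E : Type*} [Fintype E] [DecidableEq E] [Fintype V] [DecidableEq V]
  {R : Type*} [Field R] [LinearOrder R] [IsStrictOrderedRing R]

/-! ## The events at a pendant `b` -/

section Events

variable {ends : E → Sym2 V} {f : E} {a₃ b : V}

/-- `b ∉ C₁ ∪ C₂`: the star-free event that `b` is outside both root clusters. -/
def bN (ends : E → Sym2 V) (a₁ a₂ b : V) : Set (Config E) :=
  (connEvent ends a₁ b)ᶜ ∩ (connEvent ends a₂ b)ᶜ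

omit [Fintype E] [DecidableEq E] [Fintype V] [DecidableEq V] in
/-- `Q` is free of the leaf edge at `b` when the roots differ from `a₃`. -/
lemma free_avoidAll_b (hf : ends f = s(a₃, b)) (hleaf : ∀ e, a₃ ∈ ends e → e = f) (h3b : a₃ ≠ b)
    {a₁ a₂ : V} (h31 : a₃ ≠ a₁) (h32 : a₃ ≠ a₂) : Free f (avoidAll ends a₂ {a₁}) := by
  rw [avoidAll_eq_compl]
  exact (free_connEvent hf hleaf h3b (Ne.symm h31) (Ne.symm h32)).compl

omit [Fintype E] [DecidableEq E] [Fintype V] [DecidableEq V] in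
/-- `bN` is free of the leaf edge. -/
lemma free_bN (hf : ends f = s(a₃, b)) (hleaf : ∀ e, a₃ ∈ ends e → e = f) (h3b : a₃ ≠ b)
    {a₁ a₂ : V} (h31 : a₃ ≠ a₁) (h32 : a₃ ≠ a₂) : Free f (bN ends a₁ a₂ b) :=
  (free_connEvent hf hleaf h3b (Ne.symm h31) (Ne.symm h3b)).compl.inter
    (free_connEvent hf hleaf h3b (Ne.symm h32) (Ne.symm h3b)).compl

omit [Fintype E] [DecidableEq E] [Fintype V] [DecidableEq V] in
/-- **`PD = Q ∩ ({f closed} ∪ bN)`**: `a₃` is in a root cluster iff `f` is open and `b` is. -/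
lemma PDEvent_pendant_b (hf : ends f = s(a₃, b)) (hleaf : ∀ e, a₃ ∈ ends e → e = f) (h3b : a₃ ≠ b)
    {a₁ a₂ : V} (h31 : a₃ ≠ a₁) (h32 : a₃ ≠ a₂) :
    PDEvent ends a₁ a₂ a₃ = avoidAll ends a₂ {a₁} ∩ (closedEdge f ∪ bN ends a₁ a₂ b) := by
  unfold PDEvent Dtilde inU
  rw [avoidAll_eq_compl]
  ext ω
  have e1 : connEvent ends a₃ a₁ = openEdge f ∩ connEvent ends b a₁ := by
    rw [connEvent_comm ends a₃ a₁, connEvent_other_leaf hf hleaf h3b h31, connEvent_comm ends a₁ b]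
  have e2 : connEvent ends a₃ a₂ = openEdge f ∩ connEvent ends b a₂ := by
    rw [connEvent_comm ends a₃ a₂, connEvent_other_leaf hf hleaf h3b h32, connEvent_comm ends a₂ b]
  simp only [Set.mem_inter_iff, Set.mem_compl_iff, Set.mem_union, bN, e1, e2, mem_openEdge,
    mem_closedEdge, connEvent_comm ends a₁ b, connEvent_comm ends a₂ b]
  constructor
  · rintro ⟨hQ, h⟩
    refine ⟨hQ, ?_⟩
    by_cases hω : ω f = true
    · right
      exact ⟨fun hb => h (Or.inl ⟨hω, hb⟩), fun hb => h (Or.inr ⟨hω, hb⟩)⟩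
    · left; simpa using hω
  · rintro ⟨hQ, h⟩
    refine ⟨hQ, fun h' => ?_⟩
    rcases h with hc | ⟨hb1, hb2⟩
    · rcases h' with ⟨hω, _⟩ | ⟨hω, _⟩ <;> (rw [hω] at hc; exact Bool.true_eq_false.mp hc)
    · rcases h' with ⟨_, hb⟩ | ⟨_, hb⟩
      · exact hb1 hb
      · exact hb2 hb

omit [Fintype E] [DecidableEq E] [Fintype V] [DecidableEq V] in
/-- **`T = Q ∩ {f open} ∩ {b ∈ C₂}`**. -/
lemma TEvent_pendant_b (hf : ends f = s(a₃, b)) (hleaf : ∀ e, a₃ ∈ ends e → e = f) (h3b : a₃ ≠ b)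
    {a₁ a₂ : V} (h32 : a₃ ≠ a₂) :
    TEvent ends a₁ a₂ a₃ = avoidAll ends a₂ {a₁} ∩ (openEdge f ∩ connEvent ends a₂ b) := by
  unfold TEvent
  rw [avoidAll_eq_compl, connEvent_other_leaf hf hleaf h3b h32, connEvent_comm ends a₂ a₁]

omit [Fintype E] [DecidableEq E] [Fintype V] [DecidableEq V] in
/-- **`T′ = Q ∩ {f open} ∩ {b ∈ C₁}`**. -/
lemma TEvent'_pendant_b (hf : ends f = s(a₃, b)) (hleaf : ∀ e, a₃ ∈ ends e → e = f) (h3b : a₃ ≠ b)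
    {a₁ a₂ : V} (h31 : a₃ ≠ a₁) :
    TEvent ends a₂ a₁ a₃ = avoidAll ends a₂ {a₁} ∩ (openEdge f ∩ connEvent ends a₁ b) := by
  unfold TEvent
  rw [avoidAll_eq_compl, connEvent_other_leaf hf hleaf h3b h31]

end Events

/-! ## The masses at a pendant `b` -/

section Masses

variable (p : E → R) {ends : E → Sym2 V} {f : E} {a₃ b : V}

omit [Fintype V] [DecidableEq V] [LinearOrder R] [IsStrictOrderedRing R] in
/-- `P(PD ∩ X) = (1 − q) P(Q ∩ X) + q P(Q ∩ bN ∩ X)` for a free `X`. -/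
lemma prob_PD_inter_b (hf : ends f = s(a₃, b)) (hleaf : ∀ e, a₃ ∈ ends e → e = f) (h3b : a₃ ≠ b)
    {a₁ a₂ : V} (h31 : a₃ ≠ a₁) (h32 : a₃ ≠ a₂) {X : Set (Config E)} (hX : Free f X) :
    prob p (PDEvent ends a₁ a₂ a₃ ∩ X) =
      (1 - p f) * prob p (avoidAll ends a₂ {a₁} ∩ X) +
        p f * prob p (avoidAll ends a₂ {a₁} ∩ bN ends a₁ a₂ b ∩ X) := by
  rw [PDEvent_pendant_b hf hleaf h3b h31 h32]
  have hQ := free_avoidAll_b hf hleaf h3b h31 h32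
  have hN := free_bN hf hleaf h3b h31 h32
  have e : avoidAll ends a₂ {a₁} ∩ (closedEdge f ∪ bN ends a₁ a₂ b) ∩ X =
      (avoidAll ends a₂ {a₁} ∩ X ∩ closedEdge f) ∪
        (avoidAll ends a₂ {a₁} ∩ bN ends a₁ a₂ b ∩ X ∩ openEdge f) := by
    ext ω
    simp only [Set.mem_inter_iff, Set.mem_union, mem_closedEdge, mem_openEdge]
    constructor
    · rintro ⟨⟨hQ, hc | hb⟩, hx⟩
      · exact Or.inl ⟨⟨hQ, hx⟩, hc⟩
      · by_cases hω : ω f = true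
        · exact Or.inr ⟨⟨⟨hQ, hb⟩, hx⟩, hω⟩
        · exact Or.inl ⟨⟨hQ, hx⟩, by simpa using hω⟩
    · rintro (⟨⟨hQ, hx⟩, hc⟩ | ⟨⟨⟨hQ, hb⟩, hx⟩, _⟩)
      · exact ⟨⟨hQ, Or.inl hc⟩, hx⟩
      · exact ⟨⟨hQ, Or.inr hb⟩, hx⟩
  rw [e, prob_union_of_disjoint]
  · rw [prob_inter_closedEdge_of_free p (hQ.inter hX),
      prob_inter_openEdge_of_free p ((hQ.inter hN).inter hX)]
    ring
  · rw [Set.disjoint_left]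
    rintro ω ⟨_, hc⟩ ⟨_, ho⟩
    simp only [mem_closedEdge] at hc; simp only [mem_openEdge] at ho
    rw [ho] at hc; exact Bool.true_eq_false.mp hc

omit [Fintype V] [DecidableEq V] [LinearOrder R] [IsStrictOrderedRing R] in
/-- `P(T ∩ X) = q P(Q ∩ {b ∈ C₂} ∩ X)` for a free `X`. -/
lemma prob_T_inter_b (hf : ends f = s(a₃, b)) (hleaf : ∀ e, a₃ ∈ ends e → e = f) (h3b : a₃ ≠ b)
    {a₁ a₂ : V} (h31 : a₃ ≠ a₁) (h32 : a₃ ≠ a₂) {X : Set (Config E)} (hX : Free f X) :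
    prob p (TEvent ends a₁ a₂ a₃ ∩ X) =
      p f * prob p (avoidAll ends a₂ {a₁} ∩ connEvent ends a₂ b ∩ X) := by
  rw [TEvent_pendant_b hf hleaf h3b h32]
  have hQ := free_avoidAll_b hf hleaf h3b h31 h32
  have hb := free_connEvent hf hleaf h3b (Ne.symm h32) (Ne.symm h3b)
  have e : avoidAll ends a₂ {a₁} ∩ (openEdge f ∩ connEvent ends a₂ b) ∩ X =
      avoidAll ends a₂ {a₁} ∩ connEvent ends a₂ b ∩ X ∩ openEdge f := by
    ext ω; simp only [Set.mem_inter_iff]; tauto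
  rw [e, prob_inter_openEdge_of_free p ((hQ.inter hb).inter hX), mul_comm]

omit [Fintype V] [DecidableEq V] [LinearOrder R] [IsStrictOrderedRing R] in
/-- `P(T′ ∩ X) = q P(Q ∩ {b ∈ C₁} ∩ X)` for a free `X`. -/
lemma prob_T'_inter_b (hf : ends f = s(a₃, b)) (hleaf : ∀ e, a₃ ∈ ends e → e = f) (h3b : a₃ ≠ b)
    {a₁ a₂ : V} (h31 : a₃ ≠ a₁) (h32 : a₃ ≠ a₂) {X : Set (Config E)} (hX : Free f X) :
    prob p (TEvent ends a₂ a₁ a₃ ∩ X) =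
      p f * prob p (avoidAll ends a₂ {a₁} ∩ connEvent ends a₁ b ∩ X) := by
  rw [TEvent'_pendant_b hf hleaf h3b h31]
  have hQ := free_avoidAll_b hf hleaf h3b h31 h32
  have hb := free_connEvent hf hleaf h3b (Ne.symm h31) (Ne.symm h3b)
  have e : avoidAll ends a₂ {a₁} ∩ (openEdge f ∩ connEvent ends a₁ b) ∩ X =
      avoidAll ends a₂ {a₁} ∩ connEvent ends a₁ b ∩ X ∩ openEdge f := by
    ext ω; simp only [Set.mem_inter_iff]; tauto
  rw [e, prob_inter_openEdge_of_free p ((hQ.inter hb).inter hX), mul_comm]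

end Masses

/-! ## The mean-field sum at a pendant `b`: the rows containing `b` carry no `b`-share -/

section Xhat

variable (p : E → R) (ends : E → Sym2 V) {f : E} {a₃ b : V}

omit [LinearOrder R] [IsStrictOrderedRing R] in
/-- The split of `X̂` by the state of the leaf edge at `b`. -/
lemma Xhat_pendant_b (hf : ends f = s(a₃, b)) (hleaf : ∀ e, a₃ ∈ ends e → e = f) (h3b : a₃ ≠ b)
    (o a₁ a₂ : V) :
    Xhat p ends o a₁ a₂ a₃ b =
      (1 - p f) * termW p ends o a₁ a₂ b {a₃} +
        ∑ W : Finset V, prob p (clusterEvent ends b (↑W : Set V) ∩ openEdge f) *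
          termW p ends o a₁ a₂ b W := by
  rw [Xhat_eq_sum]
  have hsplit : ∀ W : Finset V, prob p (clusterEvent ends a₃ (↑W : Set V)) =
      prob p (clusterEvent ends b (↑W : Set V) ∩ openEdge f) +
        (if (↑W : Set V) = {a₃} then prob p (closedEdge f) else 0) := by
    intro W
    rw [← prob_inter_add_prob_inter_compl p (clusterEvent ends a₃ (↑W : Set V)) (openEdge f),
      ← closedEdge_eq_compl, clusterEvent_leaf_inter_open hf,
      clusterEvent_leaf_inter_closed hf hleaf h3b]
    congr 1
    split_ifs <;> simp
  simp only [hsplit, add_mul, Finset.sum_add_distrib]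
  rw [add_comm]
  congr 1
  rw [Finset.sum_eq_single ({a₃} : Finset V)]
  · simp [prob_closedEdge]
  · intro W _ hW
    have : (↑W : Set V) ≠ {a₃} := by
      intro h
      apply hW
      rw [← Finset.coe_singleton] at h
      exact Finset.coe_injective h
    simp [this]
  · intro h
    exact absurd (Finset.mem_univ _) h

/-- The residual share `g_x(W) = P_{G∖W}(x ↔ o)` with the leaf edge pinned open. -/
noncomputable def gb (f : E) (x o : V) : Set V → R :=
  delClusterProb (Function.update p f 1) ends x {S : Set V | o ∈ S}

omit [LinearOrder R] [IsStrictOrderedRing R] in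
/-- On a cluster containing `b` (so touched by `f`), the residual share is `gb`. -/
lemma delConnProb_eq_gb (hf : ends f = s(a₃, b)) {W : Finset V} (hbW : b ∈ W) {x : V} (hx : x ∉ W)
    (v : V) : delConnProb p ends W x v = gb p ends f x v (↑W : Set V) := by
  classical
  have hset : {ω : Config E | cluster ends (delConfig ends (↑W : Set V) ω) x ∈ {S : Set V | v ∈ S}} =
      connDelEvent ends W x v := by
    ext ω
    simp only [Set.mem_setOf_eq, mem_cluster, mem_connDelEvent, delConfig_eq_restrict]
  unfold gb delClusterProb delConnProb
  rw [hset]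
  by_cases hv : v ∈ W
  · rw [if_pos hv, connDelEvent_eq_empty ends hx hv, prob_empty]
  · rw [if_neg hv]
    refine (prob_update_one_of_free p ?_).symm
    exact free_of_dependsOn_touches_compl ends (mem_touches_of_ends hf (Or.inr (Finset.mem_coe.2 hbW)))
      (dependsOn_connDelEvent ends W x v)

/-- The cluster functional of the rows containing `b`:
`1_{a₁ ∉ S} 1_{a₂ ∈ S} g_{a₁}(S) + 1_{a₁ ∈ S} 1_{a₂ ∉ S} g_{a₂}(S)` (the `b`-shares vanish). -/
noncomputable def Fb (f : E) (o a₁ a₂ : V) : Set V → R := fun S =>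
  ({T : Set V | a₁ ∉ T}).indicator 1 S * ({T : Set V | a₂ ∈ T}).indicator 1 S * gb p ends f a₁ o S +
    ({T : Set V | a₁ ∈ T}).indicator 1 S * ({T : Set V | a₂ ∉ T}).indicator 1 S * gb p ends f a₂ o S

omit [LinearOrder R] [IsStrictOrderedRing R] in
/-- On a cluster containing `b`, `termW` is the functional `Fb`. -/
lemma termW_eq_Fb (hf : ends f = s(a₃, b)) {W : Finset V} (o a₁ a₂ : V) (hbW : b ∈ W) :
    termW p ends o a₁ a₂ b W = Fb p ends f o a₁ a₂ (↑W : Set V) := by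
  unfold termW Fb
  by_cases h1 : a₁ ∈ W <;> by_cases h2 : a₂ ∈ W
  · simp [h1, h2]
  · have e1 : (↑W : Set V) ∉ {T : Set V | a₁ ∉ T} := fun h => h (Finset.mem_coe.2 h1)
    have e1' : (↑W : Set V) ∈ {T : Set V | a₁ ∈ T} := Finset.mem_coe.2 h1
    have e2 : (↑W : Set V) ∈ {T : Set V | a₂ ∉ T} := fun h => h2 (Finset.mem_coe.1 h)
    simp only [h1, h2, if_true, if_false, termT, delConnProb_eq_gb p ends hf hbW h2,
      Set.indicator_of_notMem e1, Set.indicator_of_mem e1', Set.indicator_of_mem e2, hbW, Pi.one_apply]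
    ring
  · have e1 : (↑W : Set V) ∈ {T : Set V | a₁ ∉ T} := fun h => h1 (Finset.mem_coe.1 h)
    have e1' : (↑W : Set V) ∉ {T : Set V | a₁ ∈ T} := fun h => h1 (Finset.mem_coe.1 h)
    have e2 : (↑W : Set V) ∈ {T : Set V | a₂ ∈ T} := Finset.mem_coe.2 h2
    simp only [h1, h2, if_true, if_false, termT, delConnProb_eq_gb p ends hf hbW h1,
      Set.indicator_of_mem e1, Set.indicator_of_notMem e1', Set.indicator_of_mem e2, hbW, Pi.one_apply]
    ring
  · simp [h1, h2, termPD, delShareMass, hbW]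

omit [LinearOrder R] [IsStrictOrderedRing R] in
/-- The rows containing `b` as a pinned expectation. -/
lemma b_sum_eq (hf : ends f = s(a₃, b)) (o a₁ a₂ : V) :
    ∑ W : Finset V, prob p (clusterEvent ends b (↑W : Set V) ∩ openEdge f) *
        termW p ends o a₁ a₂ b W =
      p f * expect (Function.update p f 1) (fun ω => Fb p ends f o a₁ a₂ (cluster ends ω b)) := by
  rw [← expect_indicator_openEdge_mul, ← sum_prob_clusterEvent_inter_mul]
  refine Finset.sum_congr rfl fun W _ => ?_
  by_cases hb : b ∈ W
  · rw [termW_eq_Fb p ends hf o a₁ a₂ hb]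
  · have hempty : clusterEvent ends b (↑W : Set V) ∩ openEdge f = ∅ := by
      ext ω
      simp only [Set.mem_inter_iff, mem_clusterEvent, Set.mem_empty_iff_false, iff_false, not_and]
      intro h
      exact absurd (Finset.mem_coe.1 (h ▸ mem_cluster_self ends ω b)) hb
    rw [hempty, prob_empty, zero_mul, zero_mul]

omit [DecidableEq V] [LinearOrder R] [IsStrictOrderedRing R] in
/-- `E'[Fb(C_b)] = P'(a₂ ∈ C_b, o ∈ C₁, b ↮ a₁) + P'(a₁ ∈ C_b, o ∈ C₂, b ↮ a₂)`. -/
lemma expect_Fb (o a₁ a₂ : V) :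
    expect (Function.update p f 1) (fun ω => Fb p ends f o a₁ a₂ (cluster ends ω b)) =
      prob (Function.update p f 1) (connEvent ends b a₂ ∩ connEvent ends a₁ o ∩
          (connEvent ends b a₁)ᶜ) +
        prob (Function.update p f 1) (connEvent ends b a₁ ∩ connEvent ends a₂ o ∩
          (connEvent ends b a₂)ᶜ) := by
  have h1 := prob_clusterIn_inter_eq_expect (Function.update p f 1) ends b a₁
    {S : Set V | a₂ ∈ S} {S : Set V | o ∈ S}
  have h2 := prob_clusterIn_inter_eq_expect (Function.update p f 1) ends b a₂
    {S : Set V | a₁ ∈ S} {S : Set V | o ∈ S}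
  rw [clusterInEvent_mem_eq, clusterInEvent_mem_eq] at h1 h2
  rw [h1, h2, ← expect_add]
  refine congrArg _ (funext fun ω => ?_)
  simp only [Fb, Pi.add_apply, gb]
  have hQ1 : ((connEvent ends b a₁)ᶜ).indicator (1 : Config E → R) ω =
      ({T : Set V | a₁ ∉ T}).indicator 1 (cluster ends ω b) := by
    by_cases h : a₁ ∈ cluster ends ω b
    · rw [Set.indicator_of_notMem (show ω ∉ (connEvent ends b a₁)ᶜ from fun h' => h' h),
        Set.indicator_of_notMem (show cluster ends ω b ∉ {T : Set V | a₁ ∉ T} from fun h' => h' h)]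
    · rw [Set.indicator_of_mem (show ω ∈ (connEvent ends b a₁)ᶜ from h),
        Set.indicator_of_mem (show cluster ends ω b ∈ {T : Set V | a₁ ∉ T} from h)]
      rfl
  have hQ2 : ((connEvent ends b a₂)ᶜ).indicator (1 : Config E → R) ω =
      ({T : Set V | a₂ ∉ T}).indicator 1 (cluster ends ω b) := by
    by_cases h : a₂ ∈ cluster ends ω b
    · rw [Set.indicator_of_notMem (show ω ∉ (connEvent ends b a₂)ᶜ from fun h' => h' h),
        Set.indicator_of_notMem (show cluster ends ω b ∉ {T : Set V | a₂ ∉ T} from fun h' => h' h)]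
    · rw [Set.indicator_of_mem (show ω ∈ (connEvent ends b a₂)ᶜ from h),
        Set.indicator_of_mem (show cluster ends ω b ∈ {T : Set V | a₂ ∉ T} from h)]
      rfl
  rw [hQ1, hQ2]
  ring

end Xhat

end HMFPendantB

end Summit.Ventures.PercRepro2
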